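import Literature.Probability.RandomPlanarGeometry.BrownianBubbles
import Literature.Probability.RandomPlanarGeometry.RestrictionMeasuresBubbles
import Literature.Probability.RandomPlanarGeometry.SLEKappaRho
import Literature.Probability.RandomPlanarGeometry.LoewnerInverse
import Literature.Probability.RandomPlanarGeometry.SLE
import Literature.Probability.Process.PoissonCloud
import Mathlib.MeasureTheory.Measure.Lebesgue.Basic
import HarnessLib

/-!
# Adding a Poisson cloud of bubbles to SLE_κ ([LSW] §7.2): the set `Ξ(κ)`, Theorem 7.3, and `P_α`, `α > 5/8`, has interior points

Level 4 of the decomposition of the named fact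
`Literature.Probability.RandomPlanarGeometry.IsRestrictionMeasure.eq_five_eighths_of_simple` /
`…eq_five_eighths_of_outer_simple` (files `RestrictionMeasures`, `RestrictionMeasuresFiveEighths`,
`SLEKappaRho`, `BrownianBubbles`): its `α > 5/8` leaf
`IsRestrictionMeasure.ae_interior_nonempty_of_gt_five_eighths` ("for `α > 5/8`, `P_α`-almost
every configuration has an interior point") is reduced here to printed statements about the
construction of

* G. F. Lawler, O. Schramm, W. Werner, *Conformal restriction: the chordal case*, J. Amer. Math.
  Soc. **16** (2003) 917–955, arXiv:math/0209343 (**[LSW]**), §7.2 "Adding a Poisson cloud of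
  bubbles to SLE" (arXiv pp. 28–29), verbatim: "Suppose that `κ ≤ 8/3` and, as in §5, let
  `α = α_κ = (6 − κ)/(2κ)`, `λ = λ_κ = (8 − 3κ)(6 − κ)/(2κ)`. Consider a Poisson point process
  `X` on `Ω_b × [0, ∞)` with mean (intensity) `λ μ × dt`, where `dt` is Lebesgue measure […].
  As before, let `γ` denote the SLE_κ path, `g_t` the corresponding conformal maps, and `W_t`
  the Loewner driving process. We take `γ` to be independent from `X`. […] Let
  `X̂ := {g_t⁻¹(K + W_t) : (K, t) ∈ X, t ∈ [0, ∞)}`, and let `Ξ` be the filling of the union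
  of elements of `X̂` and `γ`, `Ξ = Ξ(κ) := F^ℝ_ℍ(γ(0, ∞) ∪ ⋃ X̂)`. […] **Theorem 7.3.** For any
  `κ ∈ [0, 8/3]`, the law of `Ξ(κ)` is `P_{α_κ}`." and (p. 29) "The theorem shows that for all
  `α > 5/8`, the measure `P_α` exists and can be constructed by adding bubbles with appropriate
  intensity to SLE_κ with `κ = 6/(2α + 1)`."

(The same construction, with `κ = 6/(2α + 1)`, `λ = (8 − 3κ)α`, is G. F. Lawler, *Conformally
Invariant Processes in the Plane* (2005), Def. 5.31 "bubble soup" and §9.4.)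

Contents:

* `Literature.Probability.RandomPlanarGeometry.twoSidedFilling A` — `F^ℝ_ℍ(A)` ([LSW] §2 p. 8:
  "the union of `A` with the connected components of `ℍ̄ ∖ A` which do not intersect `ℝ`"),
  the TWO-SIDED filling (the one producing elements of `Ω`, p. 7 "`K = F^ℝ_ℍ(γ) ∈ Ω`"),
  contained in the one-sided `leftFilling = F^{ℝ₊}_ℍ = Fill₋` of `SLEKappaRho` (whose mirror
  `Fill₊` is `RestrictionSides`' notion); `A ∩ ℍ̄ ⊆ F^ℝ_ℍ(A) ⊆ F^{ℝ₊}_ℍ(A)` (PROVED);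
* `Literature.Probability.RandomPlanarGeometry.timeMeasure` — Lebesgue measure `dt` on `[0, ∞)`
  as a measure on `ℝ≥0`; `sleBubbleExponent κ = α_κ`, `sleBubbleIntensity κ = λ_κ`,
  `sleKappaOfExponent α = 6/(2α + 1)` and their algebra (PROVED: `α_{κ(α)} = α`,
  `0 < κ(α) < 8/3` for `α > 5/8`, `λ_κ > 0` for `0 < κ < 8/3`);
* `Literature.Probability.RandomPlanarGeometry.sleBubbleSet κ ω X` — **the set `Ξ(κ)`** for a
  sample `ω` of the SLE_κ driving Brownian motion (the tree's canonical space; `sleDriving`,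
  `sleTrace`, and the inverse Loewner maps `Loewner.loewnerInv = g_t⁻¹`) and a configuration
  `X ⊆ Ω_b × [0, ∞)` of the bubble cloud: `F^ℝ_ℍ(γ(0, ∞) ∪ ⋃_{(K,t) ∈ X} g_t⁻¹(K + W_t))`;
  "`γ` independent from `X`" is the product measure `preWienerMeasure ⊗ P'` on
  `(ℝ≥0 → ℝ) × Ω'`, the cloud being a Poisson cloud `X : Ω' → Set (Ω_b × ℝ≥0)` with mean
  measure `λ_κ μ ⊗ dt` (`IsPoissonCloud`, file `Probability/Process/PoissonCloud`) for a
  Brownian bubble measure `μ` (`IsBrownianBubbleMeasure`, file `BrownianBubbles`);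
* NAMED FACTS: `SLEBubbles.exists_cloud` — such clouds exist (the first sentence above, with
  Kingman's existence theorem); `SLEBubbles.exists_measurable_version` and
  `SLEBubbles.measure_disjoint` — **Theorem 7.3** unbundled as for Thm. 8.4 in `SLEKappaRho`:
  `Ξ(κ)` has a measurable `Ω`-valued version, and `P[Ξ ∩ A = ∅] = Φ'_A(0)^α` for `A ∈ 𝒬*`
  (eq. (7.3)), from which the law form `SLEBubbles.isRestrictionMeasure_map` ("the law of
  `Ξ(κ)` is `P_{α_κ}`") is PROVED; `SLEBubbles.ae_interior_nonempty` — for `0 < κ < 8/3`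
  (`λ_κ > 0`) almost surely `Ξ(κ)` has an interior point (the cloud is a.s. nonempty, `μ` being
  infinite; every bubble has interior points `μ`-a.e., `IsBrownianBubbleMeasure.ae_interior_nonempty`;
  the maps `z ↦ g_t⁻¹(z + W_t)` are open, and `F^ℝ_ℍ` only adds points);
* PROVED assembly: `exists_isRestrictionMeasure_interior_of_gt_five_eighths` (a restriction
  measure of exponent `α > 5/8` whose samples a.s. have interior points exists), hence the
  existential leaf `exists_isRestrictionMeasure_ae_interior_nonempty` of the sibling file
  `RestrictionMeasuresBubbles` (`exists_isRestrictionMeasure_ae_interior_nonempty_of_bubbles`)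
  and `IsRestrictionMeasure.ae_interior_nonempty_of_gt_five_eighths_of_bubbles` — the `α > 5/8`
  leaf from the facts of this file and `exists_isBrownianBubbleMeasure`, by uniqueness of `P_α`
  (`IsRestrictionMeasure.ae_of_exists`); finally `IsRestrictionMeasure.eq_five_eighths_of_simple`
  from printed statements of [LSW] §7 and §8 only
  (`IsRestrictionMeasure.eq_five_eighths_of_simple_of_bubbles`, with `SLEKappaRho`).

Not vendored: the closedness argument `cl Ξ = Ξ ∪ {0}` ending the proof of Thm. 7.3, Prop.
5.3 (the martingale `Y_t`), Lemmas 7.1–7.2, the loop-soup description of [LSWloops].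
-/

noncomputable section

open Set Filter Topology MeasureTheory
open UpperHalfPlane (upperHalfPlaneSet)
open scoped NNReal ENNReal
open Literature.Probability.Process (preWienerMeasure IsPoissonCloud)

namespace Literature.Probability.RandomPlanarGeometry

/-! ### The filling `F^ℝ_ℍ` ([LSW] §2 p. 8) -/

/-- **The two-sided filling `F^ℝ_ℍ(A)`** ([LSW] §2 p. 8, "Fillings"): "`F^ℝ_ℍ(A)` denotes the
union of `A` with the connected components of `ℍ̄ ∖ A` which do not intersect `ℝ`", written as
`ℍ̄` minus the components of `ℍ̄ ∖ A` of ALL real points (the one-sided `leftFilling = F^{ℝ₊}_ℍ`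
of `SLEKappaRho` removes only the components of the points of `[0, ∞)`, so
`F^ℝ_ℍ(A) ⊆ F^{ℝ₊}_ℍ(A)`; this is the filling that turns `γ(0, ∞) ∪ ⋃ X̂` into an element of the
two-sided space `Ω`, p. 7). [cite: LawlerSchrammWerner2003Restriction, §2 p. 8 (Fillings)] -/
def twoSidedFilling (A : Set ℂ) : Set ℂ :=
  {z : ℂ | 0 ≤ z.im} \ ⋃ x : ℝ, connectedComponentIn ({z : ℂ | 0 ≤ z.im} \ A) (x : ℂ)

/-- `F^ℝ_ℍ(A) ⊆ ℍ̄`. [folklore] -/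
theorem twoSidedFilling_subset (A : Set ℂ) : twoSidedFilling A ⊆ {z : ℂ | 0 ≤ z.im} := fun _ h ↦ h.1

/-- Membership in `F^ℝ_ℍ(A)`. [folklore] -/
theorem mem_twoSidedFilling_iff {A : Set ℂ} {z : ℂ} :
    z ∈ twoSidedFilling A ↔
      0 ≤ z.im ∧ ∀ x : ℝ, z ∉ connectedComponentIn ({z : ℂ | 0 ≤ z.im} \ A) (x : ℂ) := by
  simp [twoSidedFilling]

/-- `A ∩ ℍ̄ ⊆ F^ℝ_ℍ(A)`: the filling only adds points. [folklore] -/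
theorem inter_subset_twoSidedFilling (A : Set ℂ) : A ∩ {z : ℂ | 0 ≤ z.im} ⊆ twoSidedFilling A := by
  rintro z ⟨hzA, hz⟩
  exact mem_twoSidedFilling_iff.2 ⟨hz, fun x hzx ↦ (connectedComponentIn_subset _ _ hzx).2 hzA⟩

/-- `F^ℝ_ℍ(A) ⊆ F^{ℝ₊}_ℍ(A)`: the two-sided filling is contained in the one-sided (left) filling,
which removes only the components of the points of `[0, ∞)`. [folklore] -/
theorem twoSidedFilling_subset_leftFilling (A : Set ℂ) : twoSidedFilling A ⊆ leftFilling A := by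
  intro z hz
  refine mem_leftFilling_iff.2 ⟨hz.1, fun x _ hx ↦ ?_⟩
  exact (mem_twoSidedFilling_iff.1 hz).2 x hx

/-- The interior of `A ∩ ℍ` lies in the interior of `F^ℝ_ℍ(A)`. [folklore] -/
theorem interior_inter_subset_interior_twoSidedFilling (A : Set ℂ) :
    interior (A ∩ upperHalfPlaneSet) ⊆ interior (twoSidedFilling A) :=
  interior_mono fun z hz ↦ inter_subset_twoSidedFilling A ⟨hz.1, le_of_lt (show 0 < z.im from hz.2)⟩

/-! ### Exponent, intensity, and the time measure ([LSW] §7.2) -/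

/-- `α_κ = (6 − κ)/(2κ)` ([LSW] Prop. 5.3 / §7.2); the same closed form, for real `κ`, is the
boundary weight `sleBoundaryWeight` of `Literature/Barriers/…/SAWNoUnitaryCFT` (not imported
here: Literature layering). [cite: LawlerSchrammWerner2003Restriction, §7.2 (p. 28)] -/
def sleBubbleExponent (κ : ℝ≥0) : ℝ := (6 - κ) / (2 * κ)

/-- `λ_κ = (8 − 3κ)(6 − κ)/(2κ)` ([LSW] Prop. 5.3 / §7.2), as a real number; `λ_κ = −c(κ)`, minus
the central charge `sleCentralCharge` of `Literature/Barriers/…/SAWNoUnitaryCFT` (cf. [LSW] p. 4: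
"`−λ(κ)` is the central charge"; not imported here).
[cite: LawlerSchrammWerner2003Restriction, §7.2 (p. 28)] -/
def sleBubbleIntensityReal (κ : ℝ≥0) : ℝ := (8 - 3 * κ) * (6 - κ) / (2 * κ)

/-- `λ_κ` as the `ℝ≥0∞`-valued density of the mean measure `λ μ × dt`.
[cite: LawlerSchrammWerner2003Restriction, §7.2 (p. 28)] -/
def sleBubbleIntensity (κ : ℝ≥0) : ℝ≥0∞ := ENNReal.ofReal (sleBubbleIntensityReal κ)

/-- `κ(α) = 6/(2α + 1)` ([LSW] p. 29: "adding bubbles with appropriate intensity to SLE_κ with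
`κ = 6/(2α + 1)`"), as an element of `ℝ≥0` (`Real.toNNReal`; the documented junk value `0` for
`α < −1/2` is never used: `α > 5/8` throughout). [cite: LawlerSchrammWerner2003Restriction, §7.2 (p. 29)] -/
def sleKappaOfExponent (α : ℝ) : ℝ≥0 := (6 / (2 * α + 1)).toNNReal

/-- `κ(α) = 6/(2α + 1)` as a real number, for `α ≥ 0`. [cite: LawlerSchrammWerner2003Restriction, §7.2 (p. 29)] -/
theorem coe_sleKappaOfExponent {α : ℝ} (hα : 0 ≤ α) : (sleKappaOfExponent α : ℝ) = 6 / (2 * α + 1) := by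
  rw [sleKappaOfExponent, Real.coe_toNNReal _ (div_nonneg (by norm_num) (by linarith))]

/-- `κ(α) > 0` for `α ≥ 0`. [cite: LawlerSchrammWerner2003Restriction, §7.2 (p. 29)] -/
theorem sleKappaOfExponent_pos {α : ℝ} (hα : 0 ≤ α) : 0 < sleKappaOfExponent α := by
  rw [← NNReal.coe_pos, coe_sleKappaOfExponent hα]
  positivity

/-- `κ(α) < 8/3` for `α > 5/8` ("for all `α > 5/8` … SLE_κ with `κ = 6/(2α + 1)`", `κ < 8/3`).
[cite: LawlerSchrammWerner2003Restriction, §7.2 (p. 29)] -/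
theorem sleKappaOfExponent_lt {α : ℝ} (hα : 5 / 8 < α) : sleKappaOfExponent α < 8 / 3 := by
  rw [← NNReal.coe_lt_coe, coe_sleKappaOfExponent (by linarith)]
  rw [div_lt_iff₀ (by linarith)]
  push_cast
  linarith

/-- `α_{κ(α)} = α` for `α ≥ 0`. [cite: LawlerSchrammWerner2003Restriction, §7.2 (p. 29)] -/
theorem sleBubbleExponent_sleKappaOfExponent {α : ℝ} (hα : 0 ≤ α) :
    sleBubbleExponent (sleKappaOfExponent α) = α := by
  rw [sleBubbleExponent, coe_sleKappaOfExponent hα]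
  have h : (2 * α + 1) ≠ 0 := by linarith
  field_simp
  ring

/-- `λ_κ > 0` for `0 < κ < 8/3` ("`λ_{8/3} = 0`", `λ_κ > 0` below). [cite: LawlerSchrammWerner2003Restriction, §7.2 (p. 29)] -/
theorem sleBubbleIntensityReal_pos {κ : ℝ≥0} (h0 : 0 < κ) (h : κ < 8 / 3) : 0 < sleBubbleIntensityReal κ := by
  have h0' : (0 : ℝ) < κ := by exact_mod_cast h0
  have h' : (κ : ℝ) < 8 / 3 := by exact_mod_cast h
  unfold sleBubbleIntensityReal
  have h1 : (0 : ℝ) < 8 - 3 * κ := by linarith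
  have h2 : (0 : ℝ) < 6 - κ := by linarith
  positivity

/-- **Lebesgue measure `dt` on `[0, ∞)`** as a measure on `ℝ≥0` (the image of Lebesgue measure on
`[0, ∞) ⊆ ℝ` under `Real.toNNReal`; the time factor of the mean measure `λ μ × dt` of [LSW] §7.2).
[cite: LawlerSchrammWerner2003Restriction, §7.2 (p. 28)] -/
def timeMeasure : Measure ℝ≥0 := ((volume : Measure ℝ).restrict (Ici 0)).map Real.toNNReal

/-- The mean measure `λ_κ μ × dt` of the bubble cloud of [LSW] §7.2 on `Ω_b × [0, ∞)`.
[cite: LawlerSchrammWerner2003Restriction, §7.2 (p. 28)] -/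
def bubbleCloudIntensity (κ : ℝ≥0) (μ : Measure BubbleConfig) : Measure (BubbleConfig × ℝ≥0) :=
  sleBubbleIntensity κ • μ.prod timeMeasure

/-! ### The set `Ξ(κ)` ([LSW] §7.2) -/

/-- **The bubble `g_t⁻¹(K + W_t)` attached to SLE_κ at time `t`** ([LSW] §7.2:
"`X̂ := {g_t⁻¹(K + W_t) : (K, t) ∈ X}`"): the image of the translated bubble `K + W_t ⊆ ℍ` under
the inverse Loewner map `g_t⁻¹ = Loewner.loewnerInv` of the SLE_κ driving function `W = √κ B(ω)`.
[cite: LawlerSchrammWerner2003Restriction, §7.2 (p. 28)] -/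
def attachedBubble (κ : ℝ≥0) (ω : ℝ≥0 → ℝ) (K : Set ℂ) (t : ℝ≥0) : Set ℂ :=
  Loewner.loewnerInv (sleDriving κ ω) t '' ((fun z ↦ z + sleDriving κ ω t) '' K)

/-- **The set `Ξ(κ) = F^ℝ_ℍ(γ(0, ∞) ∪ ⋃ X̂)`** ([LSW] §7.2, p. 28) for a sample `ω` of the SLE_κ
driving Brownian motion on the tree's canonical space (`γ = sleTrace κ ω`) and a configuration
`X ⊆ Ω_b × [0, ∞)` of the bubble cloud. [cite: LawlerSchrammWerner2003Restriction, §7.2 (p. 28, definition of Ξ(κ))] -/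
def sleBubbleSet (κ : ℝ≥0) (ω : ℝ≥0 → ℝ) (X : Set (BubbleConfig × ℝ≥0)) : Set ℂ :=
  twoSidedFilling (sleTrace κ ω '' Ioi 0 ∪ ⋃ p ∈ X, attachedBubble κ ω (p.1 : Set ℂ) p.2)

/-- Every attached bubble of the cloud lies in `Ξ(κ)`, as far as it lies in `ℍ̄` (it does lie in
`ℍ`: `K + W_t ⊆ ℍ` and `g_t⁻¹` maps `ℍ` into `ℍ`). [folklore] -/
theorem attachedBubble_inter_subset_sleBubbleSet (κ : ℝ≥0) (ω : ℝ≥0 → ℝ)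
    {X : Set (BubbleConfig × ℝ≥0)} {p : BubbleConfig × ℝ≥0} (hp : p ∈ X) :
    attachedBubble κ ω (p.1 : Set ℂ) p.2 ∩ {z : ℂ | 0 ≤ z.im} ⊆ sleBubbleSet κ ω X := by
  rintro z ⟨hz, hzim⟩
  refine inter_subset_twoSidedFilling _ ⟨Or.inr ?_, hzim⟩
  exact mem_iUnion₂.2 ⟨p, hp, hz⟩

/-- The trace `γ(0, ∞)`, as far as it lies in `ℍ̄`, lies in `Ξ(κ)`. [folklore] -/
theorem image_sleTrace_inter_subset_sleBubbleSet (κ : ℝ≥0) (ω : ℝ≥0 → ℝ) (X : Set (BubbleConfig × ℝ≥0)) :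
    sleTrace κ ω '' Ioi 0 ∩ {z : ℂ | 0 ≤ z.im} ⊆ sleBubbleSet κ ω X := by
  rintro z ⟨hz, hzim⟩
  exact inter_subset_twoSidedFilling _ ⟨Or.inl hz, hzim⟩

/-! ### [LSW] §7.2 / Theorem 7.3 as named facts -/

/-- NAMED FACT — **the bubble cloud exists** ([LSW] §7.2, p. 28: "Consider a Poisson point
process `X` on `Ω_b × [0, ∞)` with mean (intensity) `λ μ × dt`"): for every Brownian bubble
measure `μ` and every `κ` there is a probability space carrying a Poisson cloud with mean
measure `λ_κ μ ⊗ dt` (`IsPoissonCloud`). This is Kingman's existence theorem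
(`Literature.Probability.Process.exists_isPoissonCloud`, Kingman 1993 §2.5) for this mean
measure, whose hypotheses — `μ` is σ-finite ("`ν` is a σ-finite but infinite measure", §7.1,
p. 27), `μ ⊗ dt` has no atoms, and the σ-field of `Ω_b` separates points countably — are not
proved in the tree. [cite: LawlerSchrammWerner2003Restriction, §7.2 (p. 28) with §7.1 (p. 27)] -/
def SLEBubbles.exists_cloud : Prop :=
  ∀ {μ : Measure BubbleConfig}, IsBrownianBubbleMeasure μ → ∀ κ : ℝ≥0,
    ∃ (Ω' : Type) (_ : MeasurableSpace Ω') (P' : Measure Ω') (X : Ω' → Set (BubbleConfig × ℝ≥0)),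
      IsPoissonCloud (bubbleCloudIntensity κ μ) X P'

/-- NAMED FACT — **`Ξ(κ)` is a random element of `Ω`** ([LSW] Thm. 7.3, p. 29, whose statement
"the law of `Ξ(κ)` is `P_{α_κ}`" presupposes it; end of its proof, p. 29: "all that remains is
to show that `cl Ξ = Ξ ∪ {0}`" — i.e. `Ξ ∈ Ω`, Def. 3.1): for `0 < κ ≤ 8/3`, a Brownian bubble
measure `μ` and an independent Poisson cloud `X` with mean `λ_κ μ ⊗ dt` on a probability space
`(Ω', P')`, the random set `Ξ(κ)` on `((ℝ≥0 → ℝ) × Ω', preWienerMeasure ⊗ P')` has a version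
which is a measurable map into `Ω` (avoidance σ-field, §3 p. 10). Printed ingredients: `γ` is a
simple curve in `ℍ ∪ {0}` from `0` to `∞` for `κ ≤ 8/3` ([RS], §7.2 p. 28), the closedness
argument of p. 29, connectedness of `Ξ` (bubbles are attached to `γ`) and of `ℂ ∖ cl Ξ`
(filling); implicit: measurability of `{Ξ ∩ A = ∅}`.
[cite: LawlerSchrammWerner2003Restriction, Thm. 7.3 and end of its proof (p. 29)] -/
def SLEBubbles.exists_measurable_version : Prop :=
  ∀ {κ : ℝ≥0}, 0 < κ → κ ≤ 8 / 3 → ∀ {μ : Measure BubbleConfig}, IsBrownianBubbleMeasure μ →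
    ∀ {Ω' : Type} [MeasurableSpace Ω'] {P' : Measure Ω'} {X : Ω' → Set (BubbleConfig × ℝ≥0)},
      IsPoissonCloud (bubbleCloudIntensity κ μ) X P' →
        ∃ Kc : (ℝ≥0 → ℝ) × Ω' → RestrictionConfig, Measurable Kc ∧
          ∀ᵐ p ∂(preWienerMeasure.prod P'), (Kc p : Set ℂ) = sleBubbleSet κ p.1 (X p.2)

/-- NAMED FACT — **[LSW] Theorem 7.3, the avoidance formula (7.3)** (pp. 28–29): "By taking
expectation and applying Theorem 5.4, we get (7.3) `P[Ξ ∩ A = ∅] = Φ'_A(0)^α`, which almost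
proves Theorem 7.3. For any `κ ∈ [0, 8/3]`, the law of `Ξ(κ)` is `P_{α_κ}`": for `0 < κ ≤ 8/3`,
a Brownian bubble measure `μ`, an independent Poisson cloud with mean `λ_κ μ ⊗ dt`, every
`A ∈ 𝒬*` with restriction map `Φ_A` and `d = Φ'_A(0)`, the `preWienerMeasure ⊗ P'`-measure of
`{Ξ(κ) ∩ A = ∅}` is `d^{α_κ}`. Proof in [LSW]: conditionally on `γ` with `γ ∩ A = ∅`, by (7.2)
and the Poisson property `P[Ξ ∩ A = ∅ | γ] = exp(λ ∫₀^∞ Sh_t(W_t)/6 dt)`, and Thm. 5.4 (the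
martingale `h_t'(W_t)^α exp(λ ∫₀ᵗ Sh_s(W_s)/6 ds)`, Prop. 5.3). Not in the tree: Prop. 5.3 /
Thm. 5.4 for `κ < 8/3`, the conditional computation.
[cite: LawlerSchrammWerner2003Restriction, Thm. 7.3 with eq. (7.3) (pp. 28–29)] -/
def SLEBubbles.measure_disjoint : Prop :=
  ∀ {κ : ℝ≥0}, 0 < κ → κ ≤ 8 / 3 → ∀ {μ : Measure BubbleConfig}, IsBrownianBubbleMeasure μ →
    ∀ {Ω' : Type} [MeasurableSpace Ω'] {P' : Measure Ω'} {X : Ω' → Set (BubbleConfig × ℝ≥0)},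
      IsPoissonCloud (bubbleCloudIntensity κ μ) X P' →
        ∀ {A : Set ℂ}, IsStarHull A →
          ∀ {Φ : ConformalEquiv (upperHalfPlaneSet \ A) upperHalfPlaneSet}, IsRestrictionMap A Φ →
            ∀ {d : ℝ}, HasRestrictionDeriv A Φ d →
              (preWienerMeasure.prod P') {p | Disjoint (sleBubbleSet κ p.1 (X p.2)) A} =
                ENNReal.ofReal (d ^ sleBubbleExponent κ)

/-- NAMED FACT — **`Ξ(κ)` has interior points for `κ < 8/3`** ([LSW] p. 29: "The theorem shows
that for all `α > 5/8`, the measure `P_α` exists and can be constructed by adding bubbles with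
appropriate intensity to SLE_κ with `κ = 6/(2α + 1)`. The frontier of the set defined under `P_α`
has Hausdorff dimension `4/3` (because of the Brownian bubbles)"): for `0 < κ < 8/3` (so that
`λ_κ > 0`), a Brownian bubble measure `μ` and an independent Poisson cloud with mean
`λ_κ μ ⊗ dt`, almost surely `Ξ(κ)` has an interior point. Ingredients: the cloud is a.s.
nonempty (its mean measure is infinite, `μ` being infinite — [LSW] §7.1 "σ-finite but infinite";
`IsPoissonCloud.ae_nonempty_of_measure_univ`); `μ`-a.e. bubble has interior points
(`IsBrownianBubbleMeasure.ae_interior_nonempty`, folklore) and a.s. every bubble of the cloud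
does; `z ↦ g_t⁻¹(z + W_t)` is an open map of `ℍ` (a conformal map onto `H_t`); and
`F^ℝ_ℍ` only adds points (`attachedBubble_inter_subset_sleBubbleSet`). [folklore] -/
def SLEBubbles.ae_interior_nonempty : Prop :=
  ∀ {κ : ℝ≥0}, 0 < κ → κ < 8 / 3 → ∀ {μ : Measure BubbleConfig}, IsBrownianBubbleMeasure μ →
    ∀ {Ω' : Type} [MeasurableSpace Ω'] {P' : Measure Ω'} {X : Ω' → Set (BubbleConfig × ℝ≥0)},
      IsPoissonCloud (bubbleCloudIntensity κ μ) X P' →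
        ∀ᵐ p ∂(preWienerMeasure.prod P'), (interior (sleBubbleSet κ p.1 (X p.2))).Nonempty

/-! ### Theorem 7.3 in law form, and the `α > 5/8` leaf -/

/-- The preimage of an avoidance event under a version of `Ξ` is a.e. the avoidance set of `Ξ`.
[folklore] -/
theorem SLEBubbles.preimage_avoid_ae_eq {κ : ℝ≥0} {Ω' : Type} [MeasurableSpace Ω'] {P' : Measure Ω'}
    {X : Ω' → Set (BubbleConfig × ℝ≥0)} {Kc : (ℝ≥0 → ℝ) × Ω' → RestrictionConfig}
    (hae : ∀ᵐ p ∂(preWienerMeasure.prod P'), (Kc p : Set ℂ) = sleBubbleSet κ p.1 (X p.2)) (A : Set ℂ) :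
    (Kc ⁻¹' RestrictionConfig.avoid A : Set ((ℝ≥0 → ℝ) × Ω')) =ᵐ[preWienerMeasure.prod P']
      {p | Disjoint (sleBubbleSet κ p.1 (X p.2)) A} :=
  hae.mono fun p hp ↦ by
    show (Kc p ∈ RestrictionConfig.avoid A) = Disjoint (sleBubbleSet κ p.1 (X p.2)) A
    rw [RestrictionConfig.mem_avoid, hp]

/-- **[LSW] Theorem 7.3 in law form** ("For any `κ ∈ [0, 8/3]`, the law of `Ξ(κ)` is `P_{α_κ}`"),
PROVED from its two halves (`h₁`: an `Ω`-valued version `Kc` of `Ξ(κ)`; `h₂`: the avoidance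
formula (7.3)): `law(Kc) = P_{α_κ}` (`IsRestrictionMeasure`). [cite: LawlerSchrammWerner2003Restriction, Thm. 7.3 (p. 29)] -/
theorem SLEBubbles.isRestrictionMeasure_map
    (h₁ : SLEBubbles.exists_measurable_version) (h₂ : SLEBubbles.measure_disjoint)
    {κ : ℝ≥0} (hκ0 : 0 < κ) (hκ : κ ≤ 8 / 3) {μ : Measure BubbleConfig} (hμ : IsBrownianBubbleMeasure μ)
    {Ω' : Type} [MeasurableSpace Ω'] {P' : Measure Ω'} {X : Ω' → Set (BubbleConfig × ℝ≥0)}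
    (hX : IsPoissonCloud (bubbleCloudIntensity κ μ) X P') :
    ∃ Kc : (ℝ≥0 → ℝ) × Ω' → RestrictionConfig, Measurable Kc ∧
      (∀ᵐ p ∂(preWienerMeasure.prod P'), (Kc p : Set ℂ) = sleBubbleSet κ p.1 (X p.2)) ∧
        IsRestrictionMeasure (sleBubbleExponent κ) ((preWienerMeasure.prod P').map Kc) := by
  obtain ⟨Kc, hKc, hae⟩ := h₁ hκ0 hκ hμ hX
  haveI : IsProbabilityMeasure preWienerMeasure := isProbabilityMeasure_preWienerMeasure'
  haveI : IsProbabilityMeasure P' := hX.isProbabilityMeasure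
  -- the image-law lemma of `RestrictionMeasuresBubbles`, the avoidance probabilities of the
  -- version `Kc` being those of `Ξ` up to the null set where they differ
  refine ⟨Kc, hKc, hae, IsRestrictionMeasure.map_of_measure_disjoint hKc fun {A} hA Φ hΦ d hd ↦ ?_⟩
  rw [show {p | Disjoint ((Kc p : Set ℂ)) A} = Kc ⁻¹' RestrictionConfig.avoid A from rfl,
    measure_congr (SLEBubbles.preimage_avoid_ae_eq hae A)]
  exact h₂ hκ0 hκ hμ hX hA hΦ hd

/-- **Existence of `P_α` with interior points for `α > 5/8`** ([LSW] p. 29: "for all `α > 5/8`,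
the measure `P_α` exists and can be constructed by adding bubbles with appropriate intensity to
SLE_κ with `κ = 6/(2α + 1)`"), PROVED from the facts of this file and the existence of the
bubble measure: the law of (a version of) `Ξ(κ(α))` is a restriction measure of exponent `α`
under which almost every configuration has an interior point.
[cite: LawlerSchrammWerner2003Restriction, Thm. 7.3 and p. 29] -/
theorem exists_isRestrictionMeasure_interior_of_gt_five_eighths
    (hμex : exists_isBrownianBubbleMeasure) (hcl : SLEBubbles.exists_cloud)
    (h₁ : SLEBubbles.exists_measurable_version) (h₂ : SLEBubbles.measure_disjoint)
    (hint : SLEBubbles.ae_interior_nonempty) {α : ℝ} (hα : 5 / 8 < α) :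
    ∃ P : Measure RestrictionConfig, IsRestrictionMeasure α P ∧
      ∀ᵐ K : RestrictionConfig ∂P, (interior (K : Set ℂ)).Nonempty := by
  obtain ⟨μ, hμ⟩ := hμex
  have hα0 : 0 ≤ α := by linarith
  set κ := sleKappaOfExponent α with hκdef
  have hκ0 : 0 < κ := sleKappaOfExponent_pos hα0
  have hκlt : κ < 8 / 3 := sleKappaOfExponent_lt hα
  obtain ⟨Ω', _, P', X, hX⟩ := hcl hμ κ
  obtain ⟨Kc, hKc, hae, hP⟩ := SLEBubbles.isRestrictionMeasure_map h₁ h₂ hκ0 hκlt.le hμ hX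
  rw [hκdef, sleBubbleExponent_sleKappaOfExponent hα0] at hP
  -- transport the a.s. interior property through the version `Kc`
  -- (`RestrictionConfig.ae_map_interior_nonempty` of `RestrictionMeasuresBubbles`)
  refine ⟨_, hP, RestrictionConfig.ae_map_interior_nonempty hKc ?_⟩
  filter_upwards [hae, hint hκ0 hκlt hμ hX] with p hp hi
  show (interior ((Kc p : RestrictionConfig) : Set ℂ)).Nonempty
  rwa [hp]

/-- **The `α > 5/8` leaf from [LSW] §7**: the named fact
`IsRestrictionMeasure.ae_interior_nonempty_of_gt_five_eighths` (`RestrictionMeasuresFiveEighths`: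
for `α > 5/8`, almost every sample of EVERY `P_α` has an interior point) follows from the
existence of the bubble measure (§7.1), of the bubble cloud (§7.2), Theorem 7.3 (version and
avoidance formula) and the interior property of `Ξ(κ)`, by uniqueness of `P_α` (Prop. 3.3,
`IsRestrictionMeasure.ae_of_exists`). [cite: LawlerSchrammWerner2003Restriction, Thm. 7.3 (pp. 28–29) with Prop. 3.3] -/
theorem IsRestrictionMeasure.ae_interior_nonempty_of_gt_five_eighths_of_bubbles
    (hμex : exists_isBrownianBubbleMeasure) (hcl : SLEBubbles.exists_cloud)
    (h₁ : SLEBubbles.exists_measurable_version) (h₂ : SLEBubbles.measure_disjoint)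
    (hint : SLEBubbles.ae_interior_nonempty) :
    IsRestrictionMeasure.ae_interior_nonempty_of_gt_five_eighths :=
  fun hP hα ↦ IsRestrictionMeasure.ae_of_exists
    (exists_isRestrictionMeasure_interior_of_gt_five_eighths hμex hcl h₁ h₂ hint hα) hP

/-- **The existential leaf of `RestrictionMeasuresBubbles` from [LSW] §7**: the named fact
`exists_isRestrictionMeasure_ae_interior_nonempty` ("for every `α > 5/8` THERE IS a `P_α`
carried by configurations with interior points", the form in which that file isolates
Thm. 7.3) follows from the existence of the bubble measure (§7.1) and of the bubble cloud
(§7.2), Theorem 7.3 (version and avoidance formula) and the interior property of `Ξ(κ)`; with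
`exists_isRestrictionMeasure_of_gt_five_eighths_of_bubbles` of that file this also gives the
existence of `P_α`, `α > 5/8` (p. 5 result 1, "if" half above `5/8`).
[cite: LawlerSchrammWerner2003Restriction, Thm. 7.3 and p. 29] -/
theorem exists_isRestrictionMeasure_ae_interior_nonempty_of_bubbles
    (hμex : exists_isBrownianBubbleMeasure) (hcl : SLEBubbles.exists_cloud)
    (h₁ : SLEBubbles.exists_measurable_version) (h₂ : SLEBubbles.measure_disjoint)
    (hint : SLEBubbles.ae_interior_nonempty) :
    exists_isRestrictionMeasure_ae_interior_nonempty :=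
  fun _ hα ↦ exists_isRestrictionMeasure_interior_of_gt_five_eighths hμex hcl h₁ h₂ hint hα

/-- **[LSW] p. 5 result 2, first sentence (`∀ᵐ` reading), from printed statements of §7 and §8
only**: a two-sided restriction measure `P_α` almost every sample of which is a simple curve has
`α = 5/8` (`IsRestrictionMeasure.eq_five_eighths_of_simple`), from: §7.1 existence of the
Brownian bubble measure (`hμex`), §7.2 existence of the bubble cloud (`hcl`), Thm. 7.3 (`h₁`,
`h₂`) and the interior property of `Ξ(κ)` (`hint`); §8: `K = F^{ℝ₊}_ℍ(cl K_∞)` of SLE(8/3, ρ)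
is a random element of `Ω₊` (`g₁`), Thm. 8.4's avoidance formula (`g₂`) and the asymmetry of
SLE(8/3, ρ), `ρ < 0` (`g₃`, proof of Cor. 8.6).
[cite: LawlerSchrammWerner2003Restriction, p. 5 result 2; Thm. 7.3, Thm. 8.4, Cor. 8.6] -/
theorem IsRestrictionMeasure.eq_five_eighths_of_simple_of_bubbles
    (hμex : exists_isBrownianBubbleMeasure) (hcl : SLEBubbles.exists_cloud)
    (h₁ : SLEBubbles.exists_measurable_version) (h₂ : SLEBubbles.measure_disjoint)
    (hint : SLEBubbles.ae_interior_nonempty)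
    (g₁ : SLEKappaRho.exists_measurable_fill_version) (g₂ : SLEKappaRho.measure_fill_disjoint)
    (g₃ : SLEKappaRho.one_half_lt_measure_I_notMem_fill) :
    IsRestrictionMeasure.eq_five_eighths_of_simple :=
  IsRestrictionMeasure.eq_five_eighths_of_simple_of_sleKappaRho
    (SLEKappaRho.isRightRestrictionMeasure_fill_of g₁ g₂) g₃
    (IsRestrictionMeasure.ae_interior_nonempty_of_gt_five_eighths_of_bubbles hμex hcl h₁ h₂ hint)

/-- The outer-measure reading likewise. [cite: LawlerSchrammWerner2003Restriction, p. 5 result 2; Thm. 7.3, Thm. 8.4, Cor. 8.6] -/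
theorem IsRestrictionMeasure.eq_five_eighths_of_outer_simple_of_bubbles
    (hμex : exists_isBrownianBubbleMeasure) (hcl : SLEBubbles.exists_cloud)
    (h₁ : SLEBubbles.exists_measurable_version) (h₂ : SLEBubbles.measure_disjoint)
    (hint : SLEBubbles.ae_interior_nonempty)
    (g₁ : SLEKappaRho.exists_measurable_fill_version) (g₂ : SLEKappaRho.measure_fill_disjoint)
    (g₃ : SLEKappaRho.one_half_lt_measure_I_notMem_fill) :
    IsRestrictionMeasure.eq_five_eighths_of_outer_simple :=
  IsRestrictionMeasure.eq_five_eighths_of_outer_simple_of_sleKappaRho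
    (SLEKappaRho.isRightRestrictionMeasure_fill_of g₁ g₂) g₃
    (IsRestrictionMeasure.ae_interior_nonempty_of_gt_five_eighths_of_bubbles hμex hcl h₁ h₂ hint)

end Literature.Probability.RandomPlanarGeometry

end
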